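import Literature.NumberTheory.Automorphic.ResGLnCuspidalEigenclass
import Literature.NumberTheory.Automorphic.AutomorphicRepsGLSatakeScalars
import Literature.NumberTheory.Automorphic.AutomorphicRepsGLSatakeFlathProofs
import HarnessLib

/-!
# `ResGLnCohomology.cuspidalEigenclass_exists` from the Eichler–Shimura–Borel COMPARISON for
# one spherical form

Topic `NumberTheory/Automorphic`; proofs-only sibling (theorems only: no definition, no named fact,
no instance) of the named fact `ResGLnCohomology.cuspidalEigenclass_exists`
(`ResGLnCuspidalEigenclass.lean`): a cuspidal `π` on `GL_n(𝔸_K)` of cohomological infinity type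
`λ^∨ + ρ` with a `K(𝔫)`-fixed form has a non-zero simultaneous `T_{v,i}`-eigenclass (`v ∤ 𝔫`) in
some `H^q(S_{K_f(𝔫)}, Ẽ_λ) = ResGLnCohomology.levelCohomology ℂ n K 𝔫 λ q` with the
Satake–Tamagawa eigenvalues `q_v^{i(n−i)/2} e_i(α_v)` [cite: Clozel1990, Lemme 3.15 and §3.5].

The printed proof has two halves.

* AUTOMORPHIC half (Satake, Flath): on the `K(𝔫)`-invariants of `π = W / W'` every double coset
  `T_{v,i}(ϖ) = [K(𝔫) t_{v,i}(ϖ) K(𝔫)]`, `v ∤ 𝔫`, acts modulo `W'` by ONE scalar, and that scalar is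
  `q_v^{i(n−i)/2} e_i(α)` for every Satake parameter `α` of `π` at `v`
  [cite: FlathCorvallis1979, Thm. 3] [cite: Clozel1990, §3.5 (p. 123)].  This half is a THEOREM of
  the tree: `AutomorphicRepData.Flath1979_heckeOperator_ofLocal_sub_smul_mem_holds`
  (`AutomorphicRepsGLSatakeFlathProofs`) with `HasSatakeParamAt.eq_esymm_of_sub_smul_mem`
  (`AutomorphicRepsGLSatakeScalars`).
* COMPARISON half (Borel–Wallach VII 2.7, Borel's regularization, Clozel's Lemme 3.14): a
  `K(𝔫)`-spherical form `φ ∈ W ∖ W'` of a cuspidal `π` of cohomological type `λ^∨ + ρ` which is an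
  eigenform modulo `W'` of the `T_{v,i}(ϖ_v)`, `v ∤ 𝔫`, with eigenvalues `c_{v,i}`, gives a NON-ZERO
  class `x ∈ H^q(S_{K_f(𝔫)}, Ẽ_λ)` in some degree `q` with `T_{v,i} x = c_{v,i} x` — the
  Hecke-equivariant injection `π_f^{K_f(𝔫)} ⊗ H^q(𝔤, K_∞; π_∞ ⊗ E_λ) ↪ H^q_cusp ⊆ H^q(S_{K_f(𝔫)}, Ẽ_λ)`
  together with `H^q(𝔤, K_∞; π_∞ ⊗ E_λ) ≠ 0` [cite: Clozel1990, Lemme 3.14, Lemme 3.15, §3.5]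
  [cite: BorelWallach2000, VII 2.5–2.7] [cite: Borel1983Regularization, Thm. 5.3, Cor. 5.5]
  [cite: Franke1998, Thm. 18] [cite: GrobnerRaghuram2014, §7.2–7.3, Thm. 39, Prop. 41].  This half
  needs the de Rham / van Est comparison of the tree's group-cohomology model with
  `(𝔤, K_∞)`-cohomology and Borel's injectivity of cuspidal cohomology, neither of which is in the
  tree; it is written out as the hypothesis `h` of the main theorem, for ONE spherical form and with
  the tree's fixed uniformisers `ϖ_v = BigHeckeGLn.uniformizerAt v` (those of
  `ResGLnCohomology.heckeT`, `BigHeckeGLn.heckeElement`).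

THIS FILE proves

* `ResGLnCohomology.cuspidalEigenclass_exists_of_eigenformComparison (h : …) :
    ResGLnCohomology.cuspidalEigenclass_exists`

— so that the discharge `cuspidalEigenclass_exists_holds` is one line once the comparison for one
spherical eigenform is a theorem.  No named fact is introduced (D-0026); nothing printed is
re-vendored.  (The same reduction, for `GL₂` over imaginary quadratic fields and the fact
`bianchi_cuspidal_regularLAlgebraic_eigenclassExists`, is
`BianchiCuspidalEigenclassOfComparison.lean`.)

## References

* L. Clozel, *Motifs et formes automorphes: applications du principe de fonctorialité*, in:
  Automorphic forms, Shimura varieties, and L-functions I (Ann Arbor 1988), Perspect. Math. 10,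
  Academic Press 1990, Lemme 3.14, Lemme 3.15, §3.5 (pp. 120–123). [Clozel1990]
* D. Flath, *Decomposition of representations into tensor products*, Corvallis 1979, Thm. 3.
  [FlathCorvallis1979]
* A. Borel, N. Wallach, *Continuous cohomology, discrete subgroups, and representations of
  reductive groups*, 2nd ed. (2000), VII 2.5–2.7. [BorelWallach2000]
* A. Borel, *Regularization theorems in Lie algebra cohomology. Applications*, Duke Math. J. 50
  (1983), Thm. 5.3, Cor. 5.5. [Borel1983Regularization]
* J. Franke, *Harmonic analysis in weighted L₂-spaces*, Ann. Sci. ÉNS 31 (1998), Thm. 18. [Franke1998]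
* H. Grobner, A. Raghuram, Int. J. Number Theory 10 (2014) = arXiv:1102.1872, §6 (Thm. 26, Rem. 27),
  §7.2–7.3 (Thm. 39, Prop. 41). [GrobnerRaghuram2014]
-/

noncomputable section

open scoped Classical
open NumberField IsDedekindDomain

namespace Literature.NumberTheory.Automorphic

namespace ResGLnCohomology

open Literature.NumberTheory.DiophantineGeometry Literature.Barriers.Langlands

/-- The fixed uniformiser `ϖ_v = BigHeckeGLn.uniformizerAt v` of the Hecke elements `t_{v,i}` has
valuation `exp (-1)`. [folklore] -/
private theorem valued_uniformizerAt {K : Type} [Field K] [NumberField K]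
    (v : HeightOneSpectrum (𝓞 K)) :
    Valued.v ((BigHeckeGLn.uniformizerAt v : (v.adicCompletion K)ˣ) : v.adicCompletion K) =
      WithZero.exp (-1 : ℤ) := by
  change Valued.v ((Classical.choose (v.valuation_exists_uniformizer K) : K) : v.adicCompletion K) = _
  rw [HeightOneSpectrum.valuedAdicCompletion_eq_valuation']
  exact Classical.choose_spec (v.valuation_exists_uniformizer K)

/-- **`ResGLnCohomology.cuspidalEigenclass_exists` from the comparison for one spherical
eigenform.**  Hypothesis `h` (the COMPARISON, not yet a theorem of the tree): for `n ≥ 1`, a number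
field `K`, a level `𝔫 ≠ 0`, dominant weights `λ = (λ_τ)_τ`, a cuspidal `π` on `GL_n(𝔸_K)` with an
infinity type whose `a`-multisets are those of the cohomological type of `λ_τ^∨` at every `τ`, and a
`K(𝔫)`-invariant form `φ ∈ W ∖ W'` which is an eigenform modulo `W'` of the double cosets
`T_{v,i}(ϖ_v) = [K(𝔫) t_{v,i}(ϖ_v) K(𝔫)]` (`heckeDiagAt n K v (uniformizerAt v) i`), `v ∤ 𝔫`, `i ≤ n`,
with eigenvalues `c_{v,i}`, some degree `q` carries a non-zero `x ∈ H^q(S_{K_f(𝔫)}, Ẽ_λ)`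
(`levelCohomology ℂ n K 𝔫 λ q`) with `T_{v,i} x = c_{v,i} x` (`heckeT`) for all `v ∤ 𝔫`, `i ≤ n` —
the Hecke-equivariant injection `π_f^{K_f(𝔫)} ⊗ H^q(𝔤, K_∞; π_∞ ⊗ E_λ) ↪ H^q(S_{K_f(𝔫)}, Ẽ_λ)`
with `H^q(𝔤, K_∞; π_∞ ⊗ E_λ) ≠ 0` [cite: Clozel1990, Lemme 3.14, Lemme 3.15 and §3.5 (pp. 120–123)]
[cite: BorelWallach2000, VII 2.5–2.7] [cite: Borel1983Regularization, Thm. 5.3 and Cor. 5.5]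
[cite: GrobnerRaghuram2014, §7.2–7.3].  Conclusion: the named fact — the scalars `c_{v,i}` exist for
EVERY `K(𝔫)`-invariant form (`Flath1979_heckeOperator_ofLocal_sub_smul_mem_holds`) and are the
Satake–Tamagawa eigenvalues `q_v^{i(n−i)/2} e_i(α)` of every Satake parameter `α` of `π` at `v`
(`HasSatakeParamAt.eq_esymm_of_sub_smul_mem`). [cite: FlathCorvallis1979, Thm. 3] -/
theorem cuspidalEigenclass_exists_of_eigenformComparison
    (h : ∀ (n : ℕ) (K : Type) [Field K] [NumberField K] (hcpt : isCompact_glFiniteIntegralLevel n K)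
      (𝔫 : Ideal (𝓞 K)) (lam : (K →+* ℂ) → Fin n → ℤ), 1 ≤ n → 𝔫 ≠ 0 →
      (∀ τ, Weight.IsDominant (lam τ)) →
      ∀ π : CuspidalAutomorphicRepData n K hcpt,
        (∃ T : InfinityType K n, π.1.HasInfinityType T ∧
          ∀ τ : K →+* ℂ, (T τ).map ArchWeight.a =
            (cohomologicalInfinityType n K (Weight.dual (lam τ)) τ).map ArchWeight.a) →
        ∀ φ ∈ π.1.W, φ ∉ π.1.W' →
          (∀ u ∈ principalCongruenceLevel n K 𝔫,
            rightTranslation (AdelicGroupData.gl n K) u φ = φ) →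
          ∀ c : HeightOneSpectrum (𝓞 K) → ℕ → ℂ,
            (∀ v : HeightOneSpectrum (𝓞 K), ¬ v.asIdeal ∣ 𝔫 → ∀ i ≤ n,
              heckeOperator (rightTranslation (AdelicGroupData.gl n K))
                  (principalCongruenceLevel n K 𝔫)
                  (heckeDiagAt n K v (BigHeckeGLn.uniformizerAt v) i) φ - c v i • φ ∈ π.1.W') →
            ∃ (q : ℕ) (x : levelCohomology ℂ n K 𝔫 lam q), x ≠ 0 ∧
              ∀ v : HeightOneSpectrum (𝓞 K), ¬ v.asIdeal ∣ 𝔫 → ∀ i ≤ n,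
                heckeT ℂ n K 𝔫 lam q v i x = c v i • x) :
    cuspidalEigenclass_exists := by
  intro n K _ _ hcpt 𝔫 lam hn h𝔫 hlam π hT hφ
  obtain ⟨φ, hφW, hφW', hfix⟩ := hφ
  -- the automorphic half: the scalars of `T_{v,i}(ϖ_v)` modulo `W'` on the `K(𝔫)`-invariants
  have hS := π.1.Flath1979_heckeOperator_ofLocal_sub_smul_mem_holds
  choose c hc using fun (v : HeightOneSpectrum (𝓞 K)) (i : ℕ) =>
    hS v (glDiagonal n (v.adicCompletion K) fun k =>
      if (k : ℕ) < i then BigHeckeGLn.uniformizerAt v else 1)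
  have hcφ : ∀ v : HeightOneSpectrum (𝓞 K), ¬ v.asIdeal ∣ 𝔫 → ∀ i ≤ n,
      heckeOperator (rightTranslation (AdelicGroupData.gl n K)) (principalCongruenceLevel n K 𝔫)
          (heckeDiagAt n K v (BigHeckeGLn.uniformizerAt v) i) φ - c v i • φ ∈ π.1.W' := by
    intro v hv i _
    rw [heckeDiagAt_eq_ofLocal_glDiagonal]
    exact hc v i h𝔫 hv φ hφW hfix
  -- the comparison for `φ`
  obtain ⟨q, x, hx, heig⟩ := h n K hcpt 𝔫 lam hn h𝔫 hlam π hT φ hφW hφW' hfix c hcφ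
  refine ⟨q, x, hx, fun v hv α hα i hi => ?_⟩
  rw [heig v hv i hi, hα.eq_esymm_of_sub_smul_mem hS h𝔫 hv (valued_uniformizerAt v) hφW hφW' hfix
    hi (hcφ v hv i hi)]
  rfl

end ResGLnCohomology

end Literature.NumberTheory.Automorphic

end
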